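import Mathlib
import Summits.ResolutionOfSingularities.ResolutionOfSingularities.Theorems.RadicialJungCleanModelsRadicalValuationRing
import HarnessLib

/-!
# Route `RadicialJung`, crux `CleanModels` (stmt-15917), stub `stub_cleanLU3Defect`: **a defectless purely inseparable
# extension of height one admits best approximations** (valuation theory, part 2 of 2)

Line `Sketch` rev 17 of crux stmt-ResolutionOfSingularities-15917; lead `res-B-lead-1` g2.  OURS; nothing here proves resolution in
characteristic `p`.  Continues `…RadicalValuationRing.lean` (the unique extension `O' = {ξ : ξ^p ∈ O}`, `e·f = [L:K]` when defectless,
term-by-sum bound for the products `aᵢ bⱼ`).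

Here: coset representatives of `|L^×|/|K^×|` realised in `L` with `1` among them (`exists_coset_family`), a residue basis containing
`1` lifted to `L°` (`exists_residue_family`), and the theorem: if `L^p ⊆ K` and `(K, K°)` is DEFECTLESS in `L`, every `θ ∈ L` has a
BEST APPROXIMATION from `K` for `O'` — some `f₀ ∈ K` with `v'(θ - f₀) ≤ v'(θ - f)` for all `f ∈ K` (multiplicative convention,
`exists_isMin_approx_of_isDefectlessIn`): expand `θ` in the valuation-independent basis `aᵢ bⱼ`, take `f₀ =` the coefficient of
`1 = a_{i₁} b_{j₁}`.  With `θ^p = g₀` this is a best `p`-th-power approximation of `g₀`, the hypothesis of ✓ `cleanLU3_of_isMin_pthPowerApprox`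
(p677129); `…CleanLU3Abhyankar.lean` feeds it with Kuhlmann's generalized stability theorem (✓ `Kuhlmann2010Stability_holds`).
-/

noncomputable section

set_option linter.dupNamespace false -- mandated namespace of this single-conjunct summit

open IsLocalRing
open Literature.AlgebraicGeometry.Resolution

namespace Summit.ResolutionOfSingularities.ResolutionOfSingularities.Theorems.RadicialJung.CleanModels

universe u

variable {K L : Type u} [Field K] [Field L] [Algebra K L] {p : ℕ} [hp : Fact p.Prime]

/-! ## Coset representatives and residue bases containing `1` -/

section Families

variable {M : Type u} [Field M] (OM : ValuationSubring M)

/-- **Coset representatives of a finite-index subgroup of the value group, realised in `M`, one of them `1`.** [folklore] -/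
theorem exists_coset_family (H : Subgroup (ValuationSubring.ValueGroup OM)ˣ) (hH : H.index ≠ 0) :
    ∃ (a : Fin H.index → M) (ha0 : ∀ i, a i ≠ 0),
      (∀ i i', i ≠ i' →
        (Units.mk0 (OM.valuation (a i)) ((Valuation.ne_zero_iff _).mpr (ha0 i)))⁻¹ *
          Units.mk0 (OM.valuation (a i')) ((Valuation.ne_zero_iff _).mpr (ha0 i')) ∉ H) ∧
      ∃ i₁, a i₁ = 1 := by
  classical
  let Q := (ValuationSubring.ValueGroup OM)ˣ ⧸ H
  haveI : Finite Q := Nat.finite_of_card_ne_zero (by rw [← Subgroup.index_eq_card]; exact hH)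
  haveI : Fintype Q := Fintype.ofFinite Q
  have hcard : Fintype.card Q = H.index := by rw [← Nat.card_eq_fintype_card, ← Subgroup.index_eq_card]
  let σ : Fin H.index ≃ Q := (Fintype.equivFinOfCardEq hcard).symm
  -- representatives in the value group, `1` for the trivial coset
  let γ : Q → (ValuationSubring.ValueGroup OM)ˣ := fun q => if q = 1 then 1 else Quotient.out q
  have hγ : ∀ q, (QuotientGroup.mk (γ q) : Q) = q := by
    intro q
    by_cases hq : q = 1
    · subst hq; simp [γ]
    · simp only [γ, if_neg hq]; exact QuotientGroup.out_eq' q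
  -- realise them in `M`
  have hξ : ∀ q, ∃ ξ : M, OM.valuation ξ = (γ q : ValuationSubring.ValueGroup OM) := fun q =>
    OM.valuation_surjective _
  choose ξ hξ using hξ
  let a : Fin H.index → M := fun i => if σ i = 1 then 1 else ξ (σ i)
  have ha : ∀ i, OM.valuation (a i) = (γ (σ i) : ValuationSubring.ValueGroup OM) := by
    intro i
    by_cases h1 : σ i = 1
    · simp only [a, γ, if_pos h1, map_one, Units.val_one]
    · simp only [a, if_neg h1]; exact hξ (σ i)
  have ha0 : ∀ i, a i ≠ 0 := fun i h0 => by
    have := ha i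
    rw [h0, map_zero] at this
    exact (γ (σ i)).ne_zero this.symm
  have hmk : ∀ i, Units.mk0 (OM.valuation (a i)) ((Valuation.ne_zero_iff _).mpr (ha0 i)) = γ (σ i) := fun i =>
    Units.ext (by rw [Units.val_mk0, ha i])
  refine ⟨a, ha0, fun i i' hii' hmem => hii' (σ.injective ?_), σ.symm 1, ?_⟩
  · rw [hmk, hmk, ← QuotientGroup.eq, hγ, hγ] at hmem
    exact hmem
  · simp only [a, Equiv.apply_symm_apply, if_true]

/-- **A residue basis containing `1`, lifted to the valuation ring.** For a subfield `L₀` of the residue field over which the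
residue field has finite positive dimension `f`, there are `b₁, …, b_f ∈ M°` with `L₀`-linearly independent residues and some
`bⱼ = 1`. [folklore] -/
theorem exists_residue_family (L₀ : Subfield (ResidueField OM)) (hf : Module.finrank L₀ (ResidueField OM) ≠ 0) :
    ∃ (b : Fin (Module.finrank L₀ (ResidueField OM)) → OM),
      LinearIndependent L₀ (fun j => residue OM (b j)) ∧ ∃ j₁, b j₁ = 1 := by
  classical
  set f := Module.finrank L₀ (ResidueField OM) with hfdef
  haveI : Module.Finite L₀ (ResidueField OM) := Module.finite_of_finrank_pos (Nat.pos_of_ne_zero hf)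
  let w := Module.finBasis L₀ (ResidueField OM)
  -- `1 = ∑ λⱼ wⱼ` with some `λ_{j₁} ≠ 0`
  obtain ⟨j₁, hj₁⟩ : ∃ j₁, w.repr 1 j₁ ≠ 0 := by
    by_contra hall
    push Not at hall
    have h0 : w.repr 1 = 0 := Finsupp.ext hall
    exact one_ne_zero (w.repr.injective (by rw [h0, map_zero]))
  let u : Fin f → ResidueField OM := Function.update w j₁ 1
  have hu1 : u j₁ = 1 := Function.update_self _ _ _
  have hune : ∀ j, j ≠ j₁ → u j = w j := fun j hj => Function.update_of_ne hj _ _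
  -- `u` spans: `w_{j₁}` is recovered from `1` and the other `wⱼ`
  have hspan : ⊤ ≤ Submodule.span L₀ (Set.range u) := by
    have hwj : ∀ j, w j ∈ Submodule.span L₀ (Set.range u) := by
      intro j
      by_cases hj : j = j₁
      · subst hj
        have h1 : (1 : ResidueField OM) = ∑ j', w.repr 1 j' • w j' := (w.sum_repr 1).symm
        rw [← Finset.add_sum_erase _ _ (Finset.mem_univ j)] at h1
        have h2 : w.repr 1 j • w j = 1 - ∑ j' ∈ Finset.univ.erase j, w.repr 1 j' • w j' := by
          rw [eq_sub_iff_add_eq]; exact h1.symm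
        have h3 : w j = (w.repr 1 j)⁻¹ • (1 - ∑ j' ∈ Finset.univ.erase j, w.repr 1 j' • w j') := by
          rw [← h2, smul_smul, inv_mul_cancel₀ hj₁, one_smul]
        rw [h3]
        refine Submodule.smul_mem _ _ (Submodule.sub_mem _ ?_ (Submodule.sum_mem _ fun j' hj' => ?_))
        · rw [← hu1]; exact Submodule.subset_span ⟨j, rfl⟩
        · have hne : j' ≠ j := (Finset.mem_erase.mp hj').1
          rw [← hune j' hne]
          exact Submodule.smul_mem _ _ (Submodule.subset_span ⟨j', rfl⟩)
      · rw [← hune j hj]; exact Submodule.subset_span ⟨j, rfl⟩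
    rw [← w.span_eq]
    exact Submodule.span_le.mpr (by rintro _ ⟨j, rfl⟩; exact hwj j)
  have hli : LinearIndependent L₀ u :=
    linearIndependent_of_top_le_span_of_card_eq_finrank hspan (by rw [Fintype.card_fin])
  -- lift
  have hlift : ∀ j, ∃ bj : OM, residue OM bj = u j ∧ (j = j₁ → bj = 1) := by
    intro j
    by_cases hj : j = j₁
    · exact ⟨1, by rw [map_one, hj, hu1], fun _ => rfl⟩
    · obtain ⟨bj, hbj⟩ := Ideal.Quotient.mk_surjective (u j)
      exact ⟨bj, hbj, fun h => absurd h hj⟩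
  choose b hb hb1 using hlift
  refine ⟨b, ?_, j₁, hb1 j₁ rfl⟩
  have : (fun j => residue OM (b j)) = u := funext hb
  rw [this]
  exact hli

end Families

/-! ## Best approximation from defectlessness -/

/-- **A defectless purely inseparable extension of height one admits best approximations**: if `L^p ⊆ K`, `O = K°` and
`(K, O)` is defectless in `L`, then every `θ ∈ L` has a best approximation from `K` for the (unique) extension `O'` of `O`
(some `f₀ ∈ K` minimises `v'(θ - f)`, multiplicative convention). Classical valuation-basis argument.
[cite: Kuhlmann2010, Section 1 (p. 3)] -/
theorem exists_isMin_approx_of_isDefectlessIn (O : ValuationSubring K)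
    (hpow : ∀ ξ : L, ∃ c : K, algebraMap K L c = ξ ^ p) [FiniteDimensional K L]
    (O' : ValuationSubring L) (hO' : O'.comap (algebraMap K L) = O)
    (hdef : IsDefectlessIn K O L) (θ : L) :
    ∃ f₀ : K, ∀ f : K, O'.valuation (θ - algebraMap K L f₀) ≤ O'.valuation (θ - algebraMap K L f) := by
  classical
  have hef := ramificationIndex_mul_inertiaDegree_eq_of_isDefectlessIn O hpow O' hO' hdef
  have hn : 0 < Module.finrank K L := Module.finrank_pos
  have he : ramificationIndex K O' ≠ 0 := fun h => by rw [h, zero_mul] at hef; omega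
  have hf : inertiaDegree K O' ≠ 0 := fun h => by rw [h, mul_zero] at hef; omega
  -- the two families
  obtain ⟨a, ha0, hdist, i₁, hi₁⟩ := exists_coset_family O' (valueSubgroup K O') he
  obtain ⟨b, hb, j₁, hj₁⟩ := exists_residue_family O' (residueSubfield K O') hf
  -- `F = K ⊆ L`
  let F : Subfield L := (algebraMap K L).fieldRange
  have hH : ∀ c : L, c ∈ F → (hc : c ≠ 0) →
      Units.mk0 (O'.valuation c) ((Valuation.ne_zero_iff _).mpr hc) ∈ valueSubgroup K O' := by
    rintro _ ⟨c₀, rfl⟩ hc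
    have hc₀ : c₀ ≠ 0 := fun h => hc (by rw [h, map_zero])
    exact (mem_valueSubgroup_iff K O' _).mpr ⟨c₀, hc₀, rfl⟩
  have hL : ∀ c : L, c ∈ F → (hc : c ∈ O') → residue O' ⟨c, hc⟩ ∈ residueSubfield K O' := by
    rintro _ ⟨c₀, rfl⟩ hc
    exact residue_mem_residueSubfield K O' c₀ hc
  -- the `aᵢ bⱼ` form an `F`-basis of `L`
  have hli := linearIndependent_mul_of_valuation_of_residue O' F (valueSubgroup K O') hH (residueSubfield K O') hL
    a ha0 hdist b hb
  let ι := Fin (valueSubgroup K O').index × Fin (Module.finrank (residueSubfield K O') (ResidueField O'))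
  haveI : Nonempty ι := ⟨(i₁, j₁)⟩
  have hcard : Fintype.card ι = Module.finrank F L := by
    rw [Fintype.card_prod, Fintype.card_fin, Fintype.card_fin, finrank_fieldRange_eq]; exact hef
  have hspan : Submodule.span F (Set.range fun r : ι => a r.1 * (b r.2 : L)) = ⊤ :=
    hli.span_eq_top_of_card_eq_finrank hcard
  have hθmem : θ ∈ Submodule.span F (Set.range fun r : ι => a r.1 * (b r.2 : L)) := by
    rw [hspan]; exact Submodule.mem_top
  obtain ⟨g, hg⟩ := (Submodule.mem_span_range_iff_exists_fun F).mp hθmem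
  have hg' : ∑ r : ι, ((g r : F) : L) * (a r.1 * (b r.2 : L)) = θ := by
    rw [← hg]
    refine Finset.sum_congr rfl fun r _ => ?_
    rw [Algebra.smul_def]
    rfl
  -- the distinguished index with `aᵢ bⱼ = 1`
  have hm0 : a (i₁, j₁).1 * (b (i₁, j₁).2 : L) = 1 := by
    simp only [hi₁, hj₁, OneMemClass.coe_one, mul_one]
  obtain ⟨f₀, hf₀⟩ := RingHom.mem_fieldRange.mp (g (i₁, j₁)).2
  refine ⟨f₀, fun f => ?_⟩
  have hsplit : ∀ h : ι → F, ∑ r : ι, ((h r : F) : L) * (a r.1 * (b r.2 : L)) =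
      ((h (i₁, j₁) : F) : L) * (a (i₁, j₁).1 * (b (i₁, j₁).2 : L)) +
        ∑ r ∈ Finset.univ.erase (i₁, j₁), ((h r : F) : L) * (a r.1 * (b r.2 : L)) :=
    fun h => (Finset.add_sum_erase _ _ (Finset.mem_univ (i₁, j₁))).symm
  have hθ' : θ = ((g (i₁, j₁) : F) : L) + ∑ r ∈ Finset.univ.erase (i₁, j₁), ((g r : F) : L) * (a r.1 * (b r.2 : L)) := by
    rw [← hg', hsplit g, hm0, mul_one]
  -- `θ - f₀` is the combination without the distinguished term
  have h0 : θ - algebraMap K L f₀ = ∑ r ∈ Finset.univ.erase (i₁, j₁), ((g r : F) : L) * (a r.1 * (b r.2 : L)) := by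
    rw [hθ', hf₀]; ring
  -- `θ - f` is the full combination with the distinguished coefficient changed
  let cf : F := ⟨algebraMap K L f, f, rfl⟩
  let g₁ : ι → F := Function.update g (i₁, j₁) (g (i₁, j₁) - cf)
  have hg₁r : ∀ r, r ≠ (i₁, j₁) → g₁ r = g r := fun r hr => Function.update_of_ne hr _ _
  have hg₁0 : g₁ (i₁, j₁) = g (i₁, j₁) - cf := Function.update_self _ _ _
  have hg₁ : ∑ r : ι, ((g₁ r : F) : L) * (a r.1 * (b r.2 : L)) = θ - algebraMap K L f := by
    rw [hsplit g₁, hθ']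
    have h1 : ∑ r ∈ Finset.univ.erase (i₁, j₁), ((g₁ r : F) : L) * (a r.1 * (b r.2 : L)) =
        ∑ r ∈ Finset.univ.erase (i₁, j₁), ((g r : F) : L) * (a r.1 * (b r.2 : L)) :=
      Finset.sum_congr rfl fun r hr => by rw [hg₁r r (Finset.mem_erase.mp hr).1]
    rw [h1, hg₁0, hm0, mul_one]
    have h2 : ((g (i₁, j₁) - cf : F) : L) = ((g (i₁, j₁) : F) : L) - algebraMap K L f := rfl
    rw [h2]
    ring
  -- every term of `θ - f` is bounded by `v'(θ - f)`; the terms `r ≠ (i₁, j₁)` are those of `θ - f₀`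
  rw [h0]
  refine Valuation.map_sum_le _ fun r hr => ?_
  have hne : r ≠ (i₁, j₁) := (Finset.mem_erase.mp hr).1
  have key := valuation_mul_le_valuation_sum O' F (valueSubgroup K O') hH (residueSubfield K O') hL a ha0 hdist b hb g₁ r
  rw [hg₁, hg₁r r hne] at key
  exact key

end Summit.ResolutionOfSingularities.ResolutionOfSingularities.Theorems.RadicialJung.CleanModels

end
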